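import Summits.AtomisticToContinuum.HydrodynamicLimit.Theses.RelayRaceLocality
import Summits.AtomisticToContinuum.HydrodynamicLimit.Theorems.RelayRaceLocalityNearConstantShortTimeHLMeansPinDefs
import HarnessLib

/-!
# Crux `NearConstantShortTimeHL` (stmt-AtomisticToContinuum-12502), line `small-tilt-domination` — objects and statics inputs of the Gronwall (S5b)

Support file for the crux `…Theses.RelayRaceLocality.NearConstantShortTimeHL`, line `small-tilt-domination`, stub
`stub_meanFieldGronwall` (lead prover-line-stmt-AtomisticToContinuum-12502-c2-0; architecture in the line's `Lines/small_tilt_domination.lean`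
header and the lead's NOTES § S5b). The Gronwall is a relative-entropy estimate at the Euler-MATCHED canonical reference `ψ^E_r` on a
diagonal grid of times; besides the line's registered inputs it consumes two STATICS facts about the matched references along the classical
solution, typed here so that they can be proved as separate stubs, together with the mesoscale objects they speak about:

* `ballKernel ℓ x` — the normalised indicator of the ball of radius `ℓ` around `x` (torus distance `Torus.euclidDist`), the test function
  of the ball-averaged empirical fields of `SuperextensiveClosureCost.MomentumClosureCost` / the line's `MomentumClosureTightnessUR`
  (verbatim the `let χ` of those statements); `mesoRadius m = m^{-1/4}`;
* `fluctuation ℓ ρ₁ θ₁ u₁ w` — the capped quadratic deviation `∫ min 1 (|ρ̃ − ρ₁|² + ‖m̃ − ρ₁u₁‖² + |ẽ − E(ρ₁,u₁,θ₁)|²) dx` of the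
  ball-averaged empirical density / momentum / energy fields of the configuration `w` from the hydrodynamic fields `(ρ₁, u₁, θ₁)` — the
  STATIC functional whose exponential moment prices the quadratic flux remainder of the Dafermos identity (Yau's "entropy controls
  fluctuations superlinearly");
* `MesoscaleSuperlinearity` — under the matched canonical local Gibbs laws of a general family, `n⁻¹ log E exp(γ n · fluctuation) ≤ κ`
  eventually, for every `κ > 0`, uniformly over boxed Lipschitz profiles (balls of `n^{1/4}` particles: CLT-scale fluctuations, product
  over `n^{3/4}` balls; tilted partition functions with a piecewise-constant tilt + Gaussian velocities given positions);
* `UniformPressureAlongSolution` — the pressures per particle `n⁻¹ log Z_N(ψ^E_r)` converge UNIFORMLY in `r ∈ [0, t]` along a classical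
  hs-Euler solution in the dilute band (pointwise: `GeneralFamilyLDA` (i), landed; uniformity: `r ↦ log Z_N(ψ^E_r)` is `n·C`-Lipschitz).

No proofs here. References: H.-T. Yau, Lett. Math. Phys. 22 (1991) §2 (entropy inequality + large deviations of the reference);
C. Kipnis – C. Landim, Scaling Limits of Interacting Particle Systems (1999) Ch. 6; E. Pulvirenti – D. Tsagkarogiannis, Comm. Math. Phys.
316 (2012) Thm 2.1 (canonical cluster expansion with slowly varying activity).
-/

noncomputable section

namespace Summit.AtomisticToContinuum.HydrodynamicLimit.Theorems.NearConstantShortTimeHL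

open scoped BigOperators ENNReal
open MeasureTheory Set Filter
open Literature.MathematicalPhysics.KineticTheory Literature.Analysis.FluidPDE Literature.Analysis.FunctionSpaces

/-- The normalised ball indicator at radius `ℓ` on `𝕋³` (torus distance `Torus.euclidDist`; normalised by the Euclidean ball volume
`4/3 π ℓ³`, exact for `ℓ < 1/2`): the `let χ` of `MomentumClosureCost` / `MomentumClosureTightnessUR`, as a named function. [folklore] -/
def ballKernel (ℓ : ℝ) (x y : T3) : ℝ :=
  if Torus.euclidDist x y < ℓ then (4 / 3 * Real.pi * ℓ ^ 3)⁻¹ else 0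

/-- The mesoscopic ball radius `ℓ_m = m^{-1/4}` of the closure statements (balls of `≍ m^{1/4}` particles). [folklore] -/
def mesoRadius (m : ℕ) : ℝ :=
  (m : ℝ) ^ (-(1 / 4 : ℝ))

/-- **The capped, mass-weighted quadratic mesoscale deviation** of a configuration `w` of `m` particles from hydrodynamic fields
`(ρ₁, u₁, θ₁)`: `∫_{𝕋³} (1 + ρ̃_w(x)) · min 1 (|ρ̃_w(x) − ρ₁(x)|² + ‖m̃_w(x) − ρ₁(x)u₁(x)‖² + |ẽ_w(x) − E(ρ₁,u₁,θ₁)(x)|²) dx`, where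
`ρ̃_w(x) = ρ_w[ballKernel ℓ x]`, `m̃_w(x) = m_w[ballKernel ℓ x]`, `ẽ_w(x) = e_w[ballKernel ℓ x]` are the ball-averaged empirical density /
momentum / energy fields (`empiricalDensityField`, `empiricalMomentumField`, `empiricalEnergyField` tested against the ball kernel). The cap
makes it the indicator-like price of "bad balls", the weight `1 + ρ̃` lets it also dominate the MASS sitting in bad balls (which carries the
flux remainder there, together with the cubic tail); values in `[0, 1 + total ball mass]`. [cite: Yau1991, §2] -/
def fluctuation {m : ℕ} (ℓ : ℝ) (ρ₁ θ₁ : T3 → ℝ) (u₁ : T3 → V3) (w : Config m (Fin 3) T3) : ℝ :=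
  ∫ x, (1 + empiricalDensityField w (ballKernel ℓ x)) *
    min 1 ((empiricalDensityField w (ballKernel ℓ x) - ρ₁ x) ^ 2 +
      ‖empiricalMomentumField w (ballKernel ℓ x) - ρ₁ x • u₁ x‖ ^ 2 +
      (empiricalEnergyField w (ballKernel ℓ x) - totalEnergyDensity (ρ₁ x) (u₁ x) (θ₁ x)) ^ 2)

/-- **MESOSCALE STATIC SUPERLINEARITY** (statics input St2 of `stub_meanFieldGronwall`). There is a packing threshold `η₁ > 0` such that
for every box size `M ≥ 1`, every `σ > 0` and every admissible family `(ε_N > 0, ε_N → 0, n_N ε_N³ → σ³)` there is an exponent `γ > 0`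
(any positive `γ` serves the Gronwall) with: for every `κ > 0`, EVENTUALLY IN `N`, simultaneously for all continuous unit-mass profiles in the box — `M⁻¹ ≤ ρ₁`, `ρ₁σ³ ≤ η₁`,
`θ₁ ∈ [M⁻¹, M]`, `‖u₁‖ ≤ M`, all three `M`-Lipschitz — the matched canonical local Gibbs law `Q_N` of `n_N` spheres of diameter `ε_N`
with profile `localGibbsProfile (ρ₁ e^{g_σ(ρ₁)}) u₁ θ₁` (`g_σ(r) = f_ex(rσ³) + rσ³ f_ex′(rσ³)`) satisfies
`∫ exp(γ n_N · fluctuation ℓ_{n_N} ρ₁ θ₁ u₁) dQ_N ≤ exp(κ n_N)` (`fluctuation` = the capped, mass-weighted quadratic deviation).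
Why true: at radius `ℓ = n^{-1/4}` each ball holds `≍ n^{1/4}` particles, the ball averages are biased by `O(Mℓ)` and fluctuate at CLT
scale `n^{-1/8}`; local large deviations of the density (tilted partition functions with a tilt constant on mesoscopic cells, canonical
cluster expansion at low density) and of momentum / energy given the positions (independent Gaussians) have rates LINEAR in the ball
particle number, so each of the `≍ n^{3/4}` balls contributes a bounded factor for `γ` below the local curvature: `log E ≤ C(γ) n^{3/4} = o(n)`.
`Q_N` is the zero measure or a probability measure (law dichotomy); for the zero measure the bound is trivial. [cite: Yau1991, §2]
[cite: PulvirentiTsagkarogiannis2012, Thm 2.1] -/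
@[conjecture] def MesoscaleSuperlinearity : Prop :=
  ∃ η₁ : ℝ, 0 < η₁ ∧ ∀ M : ℝ, 1 ≤ M → ∀ σ : ℝ, 0 < σ →
    let g : ℝ → ℝ := fun r => hsExcessFreeEnergy (r * σ ^ 3) + r * σ ^ 3 * deriv hsExcessFreeEnergy (r * σ ^ 3);
    ∀ (ε : ℕ → ℝ) (n : ℕ → ℕ), (∀ N, 0 < ε N) → Tendsto ε atTop (nhds 0) →
    Tendsto (fun N => (n N : ℝ) * ε N ^ 3) atTop (nhds (σ ^ 3)) →
    ∃ γ : ℝ, 0 < γ ∧ ∀ κ : ℝ, 0 < κ → ∀ᶠ N : ℕ in atTop,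
    ∀ (ρ₁ θ₁ : T3 → ℝ) (u₁ : T3 → V3), Continuous ρ₁ → Continuous θ₁ → Continuous u₁ → (∫ x, ρ₁ x) = 1 →
    (∀ x, M⁻¹ ≤ ρ₁ x ∧ ρ₁ x * σ ^ 3 ≤ η₁ ∧ M⁻¹ ≤ θ₁ x ∧ θ₁ x ≤ M ∧ ‖u₁ x‖ ≤ M) →
    (∀ x y, |ρ₁ x - ρ₁ y| ≤ M * dist x y ∧ ‖u₁ x - u₁ y‖ ≤ M * dist x y ∧ |θ₁ x - θ₁ y| ≤ M * dist x y) →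
    let Q : Measure (Config (n N) (Fin 3) T3) :=
      (liouville (Torus.geometry (Fin 3)) (n N) (ε N)).withDensity fun z =>
        ENNReal.ofReal (canonicalDensity (Torus.geometry (Fin 3)) (ε N) (n N)
          (localGibbsProfile (fun x => ρ₁ x * Real.exp (g (ρ₁ x))) u₁ θ₁) z);
    ∫⁻ w, ENNReal.ofReal (Real.exp (γ * (n N : ℝ) * fluctuation (mesoRadius (n N)) ρ₁ θ₁ u₁ w)) ∂Q ≤
      ENNReal.ofReal (Real.exp (κ * (n N : ℝ)))

/-- **UNIFORM PRESSURES ALONG A CLASSICAL SOLUTION** (statics input St3 of `stub_meanFieldGronwall`). There is a packing threshold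
`η₁ > 0` such that for every `σ > 0`, every admissible family and every classical hs-Euler solution `(ρ, u, θ)` on `[0, T)` of unit mass
whose packing stays `< η₁` on `[0, t]` (`t < T`), the pressures per particle of the matched canonical local Gibbs laws
`ψ^E_r` (profile `localGibbsProfile (ρ_r e^{g_σ(ρ_r)}) u_r θ_r`) converge to `∫ ρ_r · ρ_r σ³ f_ex′(ρ_r σ³)` UNIFORMLY in `r ∈ [0, t]`:
`TendstoUniformlyOn (N, r ↦ n_N⁻¹ log Z_N(ψ^E_r)) (r ↦ ∫ ρ_r ρ_r σ³ f_ex′(ρ_rσ³)) atTop [0, t]`.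
Why true: pointwise in `r` this is `GeneralFamilyLDA` (i) (landed `stub_ldaGeneralFamilies`; the solution is continuous and positive on
the compact `[0,t] × 𝕋³`, hence bounded below, and `∫ρ_r = 1` by mass conservation); uniformity because `r ↦ log Z_N(ψ^E_r)` is
differentiable with `|∂_r log Z_N| = |E_{ψ^E_r}[∑ᵢ ∂_r Λ_r(zᵢ)]| ≤ n_N · C(solution)` (time derivatives of `ρ, u, θ` are bounded on
`[0,t]`, second velocity moments are Gaussian), so the sequence is equi-Lipschitz on `[0, t]` and pointwise convergence upgrades to
uniform convergence. [cite: PulvirentiTsagkarogiannis2012, Thm 2.1] -/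
@[conjecture] def UniformPressureAlongSolution : Prop :=
  ∃ η₁ : ℝ, 0 < η₁ ∧ ∀ σ : ℝ, 0 < σ →
    let g : ℝ → ℝ := fun r => hsExcessFreeEnergy (r * σ ^ 3) + r * σ ^ 3 * deriv hsExcessFreeEnergy (r * σ ^ 3);
    ∀ (ε : ℕ → ℝ) (n : ℕ → ℕ), (∀ N, 0 < ε N) → Tendsto ε atTop (nhds 0) →
    Tendsto (fun N => (n N : ℝ) * ε N ^ 3) atTop (nhds (σ ^ 3)) →
    ∀ (T : ℝ) (ρ θ : ℝ → T3 → ℝ) (u : ℝ → T3 → V3), IsHardSphereEulerSolution σ T ρ u θ →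
    (∫ x, ρ 0 x) = 1 → ∀ t ∈ Set.Ico 0 T, (∀ s ∈ Set.Icc 0 t, ∀ x, ρ s x * σ ^ 3 < η₁) →
    TendstoUniformlyOn
      (fun N r => (n N : ℝ)⁻¹ * Real.log (canonicalPartition (Torus.geometry (Fin 3)) (ε N) (n N)
        (localGibbsProfile (fun x => ρ r x * Real.exp (g (ρ r x))) (u r) (θ r))))
      (fun r => ∫ x, ρ r x * (ρ r x * σ ^ 3 * deriv hsExcessFreeEnergy (ρ r x * σ ^ 3)))
      atTop (Set.Icc 0 t)

/-! ## Elementary properties of the objects -/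

/-- The ball kernel is nonnegative. [folklore] -/
theorem ballKernel_nonneg (ℓ : ℝ) (x y : T3) : 0 ≤ ballKernel ℓ x y := by
  unfold ballKernel
  split_ifs with h
  · have hℓ : 0 < ℓ := lt_of_le_of_lt (norm_nonneg _ : 0 ≤ Torus.euclidDist x y) h
    positivity
  · exact le_rfl

/-- The ball-averaged empirical density is nonnegative (registered helper `ballDensity_nonneg`). [folklore] -/
theorem ballDensity_nonneg : ∀ {m : ℕ} (ℓ : ℝ) (x : T3) (w : Config m (Fin 3) T3),
    0 ≤ empiricalDensityField w (ballKernel ℓ x) := by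
  intro m ℓ x w
  unfold empiricalDensityField
  exact integral_nonneg fun y => ballKernel_nonneg ℓ x y.1

/-- The fluctuation functional is nonnegative (registered helper `fluctuation_nonneg`). [folklore] -/
theorem fluctuation_nonneg : ∀ {m : ℕ} (ℓ : ℝ) (ρ₁ θ₁ : T3 → ℝ) (u₁ : T3 → V3) (w : Config m (Fin 3) T3),
    0 ≤ fluctuation ℓ ρ₁ θ₁ u₁ w := by
  intro m ℓ ρ₁ θ₁ u₁ w
  unfold fluctuation
  refine integral_nonneg fun x => mul_nonneg ?_ (le_min zero_le_one ?_)
  · linarith [ballDensity_nonneg ℓ x w]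
  · positivity

end Summit.AtomisticToContinuum.HydrodynamicLimit.Theorems.NearConstantShortTimeHL

end
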